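import Summits.ValiantsHypothesis.ValiantsHypothesis.Theorems.LacunarySymmetroidMatrixDescartesDoorA26WallBubblingQuadZeroLift

/-!
# `DoorA26` / line `wall_bubbling` — the ORDER-4 OPENING THEOREM, discriminant form

HONEST FRAMING.  Object-search cell `pub-symmetroid`, crux `Theses.LacunarySymmetroid.DoorA26` (stmt-ValiantsHypothesis-19979; OPEN, typed,
never asserted).  W2 seat val-sym-door-p1 g19, file #75; def-free helper for obligation (R) of `Cruxes/DoorA26/Lines/wall_bubbling.lean`.
#72 `mem_twentyLocus_of_quadZero` asks for a witness `σ₀ > 0` with `a·M(σ₀) < 0`, `M(σ) = aσ⁴ + A₁σ² + e₀`; this file replaces it by the natural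
data condition: `aA₁ < 0` and `4ae₀ < A₁²` (with `ae₀ > 0` as before) — take `σ₀² = −A₁/(2a)`, the vertex of the biquadratic, where
`a·M = ae₀ − A₁²/4`.  Imports #72 `…QuadZeroLift`.

WHAT IS HERE.  ★ `mem_twentyLocus_of_quadZero_disc`.  Nothing here bears on `DoorA26`, `DoorA34`, (W)/(M)/(R), `MatrixDescartes` (18050) or
`VP ≠ VNP`; registers unchanged.

[folklore] the vertex of a biquadratic.  [this work] the packaging.
-/

set_option linter.dupNamespace false

namespace Summit.ValiantsHypothesis.ValiantsHypothesis.Theorems.LacunarySymmetroidMatrixDescartes.WallBubbling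

open Finset Filter Topology
open Bubbling (TwentyLocus)

/-- ★ **THE ORDER-4 OPENING THEOREM, discriminant form**: as #72 `mem_twentyLocus_of_quadZero`, with the witness `σ₀` replaced by `aA₁ < 0` and
`4ae₀ < A₁²` (four simple real roots of the scaling biquadratic). [this work] -/
theorem mem_twentyLocus_of_quadZero_disc (δ : Fin 6 → ℝ) (S T₁ T₂ : Fin 6 → Matrix (Fin 2) (Fin 2) ℝ)
    (hS : ∀ l, (S l).IsSymm) (hT₁ : ∀ l, (T₁ l).IsSymm) (hT₂ : ∀ l, (T₂ l).IsSymm)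
    (τ : Fin 18 → ℝ) (hτ : StrictMono τ) (jstar : Fin 17) (tstar : ℝ)
    (ht1 : τ jstar.castSucc < tstar) (ht2 : tstar < τ jstar.succ)
    (κ : Fin 18 → ℝ) (halt : ∀ j : Fin 17, j ≠ jstar → κ j.castSucc * κ j.succ < 0)
    (hsame : 0 < κ jstar.castSucc * κ jstar.succ)
    (hout : ∀ j,
      0 < κ j * (∑ l, Real.exp (δ l * τ j) • S l).det ∨
      ((∑ l, Real.exp (δ l * τ j) • S l).det = 0 ∧
        0 < κ j * (((∑ l, Real.exp (δ l * τ j) • S l) + (∑ l, Real.exp (δ l * τ j) • T₁ l)).det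
              - (∑ l, Real.exp (δ l * τ j) • S l).det - (∑ l, Real.exp (δ l * τ j) • T₁ l).det)) ∨
      ((∑ l, Real.exp (δ l * τ j) • S l).det = 0 ∧
        ((∑ l, Real.exp (δ l * τ j) • S l) + (∑ l, Real.exp (δ l * τ j) • T₁ l)).det
              - (∑ l, Real.exp (δ l * τ j) • S l).det - (∑ l, Real.exp (δ l * τ j) • T₁ l).det = 0 ∧
        0 < κ j * ((((∑ l, Real.exp (δ l * τ j) • S l) + (∑ l, Real.exp (δ l * τ j) • T₂ l)).det
              - (∑ l, Real.exp (δ l * τ j) • S l).det - (∑ l, Real.exp (δ l * τ j) • T₂ l).det)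
              + (∑ l, Real.exp (δ l * τ j) • T₁ l).det)))
    (a A₁ e₀ : ℝ) (haκ : 0 < a * κ jstar.castSucc)
    (hD0 : (∑ l, Real.exp (δ l * tstar) • S l).det = 0)
    (hD1 : deriv (fun t => (∑ l, Real.exp (δ l * t) • S l).det) tstar = 0)
    (hD2 : iteratedDeriv 2 (fun t => (∑ l, Real.exp (δ l * t) • S l).det) tstar = 0)
    (hD3 : iteratedDeriv 3 (fun t => (∑ l, Real.exp (δ l * t) • S l).det) tstar = 0)
    (hD4 : iteratedDeriv 4 (fun t => (∑ l, Real.exp (δ l * t) • S l).det) tstar = 24 * a)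
    (hB0 : ((∑ l, Real.exp (δ l * tstar) • S l) + (∑ l, Real.exp (δ l * tstar) • T₁ l)).det
              - (∑ l, Real.exp (δ l * tstar) • S l).det - (∑ l, Real.exp (δ l * tstar) • T₁ l).det = 0)
    (hB1 : deriv (fun t => ((∑ l, Real.exp (δ l * t) • S l) + (∑ l, Real.exp (δ l * t) • T₁ l)).det
              - (∑ l, Real.exp (δ l * t) • S l).det - (∑ l, Real.exp (δ l * t) • T₁ l).det) tstar = 0)
    (hB2 : iteratedDeriv 2 (fun t => ((∑ l, Real.exp (δ l * t) • S l) + (∑ l, Real.exp (δ l * t) • T₁ l)).det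
              - (∑ l, Real.exp (δ l * t) • S l).det - (∑ l, Real.exp (δ l * t) • T₁ l).det) tstar = 2 * A₁)
    (hC0 : (((∑ l, Real.exp (δ l * tstar) • S l) + (∑ l, Real.exp (δ l * tstar) • T₂ l)).det
              - (∑ l, Real.exp (δ l * tstar) • S l).det - (∑ l, Real.exp (δ l * tstar) • T₂ l).det)
              + (∑ l, Real.exp (δ l * tstar) • T₁ l).det = e₀)
    (he : 0 < a * e₀) (hA : a * A₁ < 0) (hdisc : 4 * a * e₀ < A₁ ^ 2) :
    δ ∈ TwentyLocus := by
  have ha : a ≠ 0 := by rintro rfl; simp at haκ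
  have hq : 0 < -A₁ / (2 * a) := by
    have : -A₁ / (2 * a) = (-(a * A₁)) / (2 * a ^ 2) := by field_simp
    rw [this]
    exact div_pos (by linarith) (by positivity)
  set σ₀ : ℝ := Real.sqrt (-A₁ / (2 * a)) with hσ₀
  have hσpos : 0 < σ₀ := Real.sqrt_pos.2 hq
  have hsq : σ₀ ^ 2 = -A₁ / (2 * a) := by rw [hσ₀, Real.sq_sqrt hq.le]
  have hM : a * (a * σ₀ ^ 4 + A₁ * σ₀ ^ 2 + e₀) < 0 := by
    have h4 : σ₀ ^ 4 = (σ₀ ^ 2) ^ 2 := by ring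
    rw [h4, hsq]
    have : a * (a * (-A₁ / (2 * a)) ^ 2 + A₁ * (-A₁ / (2 * a)) + e₀) = a * e₀ - A₁ ^ 2 / 4 := by
      field_simp
      ring
    rw [this]
    linarith
  exact mem_twentyLocus_of_quadZero δ S T₁ T₂ hS hT₁ hT₂ τ hτ jstar tstar ht1 ht2 κ halt hsame hout a A₁ e₀ (Real.sqrt (-A₁ / (2 * a))) haκ hD0 hD1 hD2 hD3 hD4 hB0 hB1 hB2 hC0 he hσpos hM

end Summit.ValiantsHypothesis.ValiantsHypothesis.Theorems.LacunarySymmetroidMatrixDescartes.WallBubbling
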